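import Literature.Topology.FourManifolds.SurfaceGroupNielsenCoreCasePJAux
import HarnessLib

/-!
# Nielsen's theorem, pillar CORE: a portal at `a`, a junction at `b`, partner inside

Topic `Literature/Topology/FourManifolds`.  The case P-J (α) of the case analysis of a double
point `a < b` on the closed path of a potential-minimal configuration (Zieschang–Vogt–Coldewey,
LNM 835, proof of Thm. 5.3.2 with Lemma 5.3.4, in the lead's minimal-counterexample recasting):
the cut `a` is interior to the kernel of the occurrence `k` (between its slots `sa - 1 | sa`,
`sa = slotAt k a`, value `V = fac k`), the cut `b = Kstart (k₃ + 1)` is a junction with spur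
`T_b = tail k₃` of length `c_b = jc k₃`, and the partner occurrence `k̄` lies INSIDE.

* crossing edges of the fixation: the formal edges `ε_q` at the pre-cut slots `(k, q)`,
  `q < sa`, whose far end `(k̄, n - 1 - q)` is a tail slot (interval lemma), of level `q`, and
  the spur edges `β_e`, `e < c_b`, of level `e` — nothing else (Claim (A), junction criterion);
* the parity principle level by level: a level `e ≥ sa` carries only `β_e`, so `c_b ≤ sa`; a
  level `e < sa` carries `ε_e` and needs `β_e`, so `c_b ≥ sa`; hence `c_b = sa` and `ε_e`, `β_e`
  lie on one component, whose tail slots carry one letter: `T_b = (V[0, sa))⁻¹`;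
* vertices: the spur hangs at `absv b = absv a = E_k · V[0, sa)`, so its tip `E_{k₃+1}` is
  `E_k`, and the block of occurrences `k, …, k₃` (symbol-closed: `k̄` is inside, the other
  inside symbols by Claim (A); proper: `k₃ + 1 < m`) has trivial value — a decomposition,
  contradicting indecomposability (`false_of_occStart_eq`).

## References

* H. Zieschang, E. Vogt, H.-D. Coldewey, *Surfaces and Planar Discontinuous Groups*, LNM 835
  (1980), proof of Thm. 5.3.2 and Lemma 5.3.4. [ZieschangVogtColdewey1980]
-/

noncomputable section

namespace Literature.Topology.FourManifolds

open Literature.GroupTheory.CombinatorialGroupTheory CycFactors List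

namespace SurfaceGroup

namespace Config

variable {g : ℕ} {φ : surfaceGen g → SurfaceGroup g}

section PJ

variable (hg : 2 ≤ g) (hK : RelatorKilled φ) (hI : Indecomposable φ) (hM : MarkedNontrivial φ)
  (κ : Config φ) (hmin : κ.IsMin) (d : κ.DoublePoint)
include hg hK hI hM hmin

omit hK in
/-- **No double point with a portal at `a` and a junction at `b`, the partner of the portal
occurrence lying inside.**  With `sa = slotAt k a` and the spur `T_b = tail k₃` of the junction
`b = Kstart (k₃ + 1)`: the crossing edges are the formal edges `ε_q` at `(k, q)`, `q < sa`
(level `q`, far end a tail slot of `k̄`) and the spur edges `β_e`, `e < c_b` (level `e`); the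
parity principle level by level gives `c_b = sa` and `ε_e ~ β_e`, whence (tail slots of one
component carry one letter) `T_b = (V[0, sa))⁻¹`, so the tip `E_{k₃+1}` of the spur is `E_k`
and the block of occurrences `k, …, k₃` — symbol-closed by Claim (A), proper — has trivial
value, contradicting indecomposability. [cite: ZieschangVogtColdewey1980, proof of Thm. 5.3.2 and Lemma 5.3.4] -/
theorem false_of_doublePoint_PJ_inside {k : ℕ} (hPa : κ.PortalAt d.a k) (hJb : κ.IsJunction d.b)
    (hin : κ.Inside d.a d.b (κ.bar k)) : False := by
  have hg1 : 1 ≤ g := by omega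
  let _i : Inhabited (surfaceGen g) := ⟨(⟨0, by omega⟩, false)⟩
  have hN := κ.cycNielsen_U hg1 hI hM hmin
  have hU := κ.U_ne_nil hg1
  have hbar := κ.isPairing_bar
  have hab := d.lt
  have hbℓ := d.lt_length
  have hk : k < κ.w.length := κ.lt_length_of_portalAt hPa (hab.trans hbℓ).le
  have hkU : k < κ.U.length := by rw [length_U]; exact hk
  have hbkU : κ.bar k < κ.U.length := hbar.lt k hkU
  have hbk : κ.bar k < κ.w.length := by rw [← length_U]; exact hbkU
  -- the junction `b = Kstart (k₃ + 1)`, `k ≤ k₃`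
  obtain ⟨k₄, hk₄, hKb⟩ := id hJb
  have hkk₄ : k < k₄ :=
    (κ.Kstart_lt_Kstart_iff hg1 hI hM hmin).1 (by rw [hKb]; exact hPa.1.trans hab)
  obtain ⟨k₃, rfl⟩ : ∃ k₃, k₄ = k₃ + 1 := ⟨k₄ - 1, by omega⟩
  have hk₃ : k₃ < κ.w.length := by omega
  -- numerical data of the portal occurrence `k` and of the spur
  obtain ⟨hc₁sa, hsac₂⟩ := κ.slotAt_bounds_of_portalAt hg1 hI hM hmin hPa
  set n := (fac κ.U k).length with hn
  have hnbar : (fac κ.U (κ.bar k)).length = n := hbar.length_fac_bar hkU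
  set sa := κ.slotAt k d.a with hsa
  set n₃ := (fac κ.U k₃).length with hn₃
  set cb := jc κ.U k₃ with hcb
  have hcbn₃ : cb ≤ n₃ := jc_le_length κ.U k₃
  -- separation, (P2), the interval lemma
  have hsep : ∀ j, ¬ (κ.PortalAt d.a j ∧ κ.PortalAt d.b j) := fun j h =>
    κ.not_portalAt_of_isJunction hJb j h.2
  have hJa : ¬ κ.IsJunction d.a := κ.not_isJunction_of_portalAt hPa
  have hP2 := DoublePoint.kpos_mem_iff_of_chainEnd κ hg1 hI hM hmin d
  have hsaj : sa ≤ jc κ.U (κ.bar k) :=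
    κ.slotAt_le_jc_bar_of_portalAt_left_of_inside hg1 hI hM hmin hP2 hk hPa hin
  have h2sa : 2 * sa ≤ n := by
    have := (hN.pair (κ.bar k)).1
    rw [hnbar] at this
    omega
  -- the side function of the fixation
  obtain ⟨s, hs⟩ : ∃ s : ℕ × ℕ → Bool, ∀ σ, s σ = decide (κ.SideIn d.a d.b σ) := ⟨_, fun _ => rfl⟩
  have hP2s : ∀ τ, IsKernelSlot κ.U τ → s τ = s (chainEnd κ.U κ.bar τ) := fun τ hτ => by
    rw [hs, hs]
    exact κ.decide_sideIn_eq_decide_sideIn_chainEnd hg1 hI hM hmin hab hsep hP2 hτ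
  have hsf : ∀ σ, IsCrossing s (fedge κ.U κ.bar σ) ↔ κ.FCross d.a d.b σ := fun σ => by
    rw [isCrossing_fedge, hs, hs, κ.fcross_iff_decide_ne]
  have hsc : ∀ σ, IsSlot κ.U σ → ¬ IsKernelSlot κ.U σ →
      (IsCrossing s (cedge κ.U σ) ↔ κ.CCross d.a d.b σ) := fun σ h1 h2 => by
    rw [isCrossing_cedge, hs, hs, κ.ccross_iff_decide_ne h1 h2]
  -- (1) the crossing edges: `ε_q = fedge (k, q)`, `q < sa`, and `β_e = cedge (k₃, n₃-1-e)`, `e < cb`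
  have hXf : ∀ q, IsCrossing s (fedge κ.U κ.bar (k, q)) ↔ q < sa := fun q => by
    rw [hsf]
    exact κ.fcross_iff_of_portalAt_left_of_inside hsep hPa hin q
  have hXc : ∀ e, e < cb → IsCrossing s (cedge κ.U (k₃, n₃ - 1 - e)) := fun e he => by
    have ht := κ.pj_isTailSlot_spur hk₃ he
    rw [hsc _ ht.1 (fun h => h.not_isTailSlot ht)]
    exact κ.pj_ccross_spur hg1 hI hM hmin hab hbℓ hsep hk₄ hKb he
  -- their levels
  have hLf : ∀ q, q < sa → ∀ ρ ∈ (fedge κ.U κ.bar (k, q)).2, level κ.U ρ = q := fun q hq =>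
    κ.pj_level_fedge hk (by omega)
  have hLc : ∀ e, e < cb → ∀ ρ ∈ (cedge κ.U (k₃, n₃ - 1 - e)).2, level κ.U ρ = e := fun e he =>
    κ.pj_level_cedge hg1 hI hM hmin hk₃ he
  -- the crossing edges all of whose ends have level `e₀`
  have hclass : ∀ ε', IsEdge κ.U κ.bar ε' → IsCrossing s ε' → ∀ e₀,
      (∀ ρ' ∈ ε'.2, level κ.U ρ' = e₀) →
      (e₀ < sa ∧ ε' = fedge κ.U κ.bar (k, e₀)) ∨ (e₀ < cb ∧ ε' = cedge κ.U (k₃, n₃ - 1 - e₀)) := by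
    intro ε' hε' hc' e₀ hlev
    obtain ⟨σ', hσ', h' | ⟨hkσ', h'⟩⟩ := hε'
    · subst h'
      obtain ⟨q, -, hcq, he⟩ :=
        κ.pj_fcross_classify hg1 hI hM hmin hP2 hk hPa hJb hσ' ((hsf σ').1 hc')
      have hq : q < sa := (κ.fcross_iff_of_portalAt_left_of_inside hsep hPa hin q).1 hcq
      have hl := hlev (k, q) (by rw [he]; exact mem_fedge.2 (Or.inl rfl))
      rw [hLf q hq (k, q) (mem_fedge.2 (Or.inl rfl))] at hl
      subst hl
      exact Or.inl ⟨hq, he⟩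
    · subst h'
      obtain ⟨e, he, hle, hee⟩ := κ.pj_ccross_classify hg1 hI hM hmin hab hbℓ hsep hJa hk₄ hKb
        hσ' hkσ' ((hsc σ' hσ' hkσ').1 hc')
      have hl := hlev σ' (mem_cedge.2 (Or.inl rfl))
      rw [hle] at hl
      subst hl
      exact Or.inr ⟨he, hee⟩
  -- (2) parity: `cb ≤ sa` (else `β_sa` is alone at its level) ...
  have hcb1 : cb ≤ sa := by
    by_contra hlt
    have hlt' : sa < cb := by omega
    have ht := κ.pj_isTailSlot_spur hk₃ hlt'
    refine false_of_crossing_alone_level hN hU hbar hP2s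
      (isEdge_cedge ht.1 fun h => h.not_isTailSlot ht) (hXc sa hlt')
      ⟨(k₃, n₃ - 1 - sa), mem_cedge.2 (Or.inl rfl), hLc sa hlt' _ (mem_cedge.2 (Or.inl rfl))⟩
      fun ε' hε' hc' hlev => ?_
    rcases hclass ε' hε' hc' sa hlev with ⟨h1, -⟩ | ⟨-, h2⟩
    · exact absurd h1 (lt_irrefl _)
    · exact h2
  -- ... and `sa ≤ cb` (else `ε_cb` is alone at its level)
  have hcb2 : sa ≤ cb := by
    by_contra hlt
    have hlt' : cb < sa := by omega
    have hσ : IsSlot κ.U (k, cb) := ⟨hkU, by dsimp only; omega⟩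
    refine false_of_crossing_alone_level hN hU hbar hP2s (isEdge_fedge hσ) ((hXf cb).2 hlt')
      ⟨(k, cb), mem_fedge.2 (Or.inl rfl), hLf cb hlt' _ (mem_fedge.2 (Or.inl rfl))⟩
      fun ε' hε' hc' hlev => ?_
    rcases hclass ε' hε' hc' cb hlev with ⟨-, h1⟩ | ⟨h2, -⟩
    · exact h1
    · exact absurd h2 (lt_irrefl _)
  have hcbsa : cb = sa := le_antisymm hcb1 hcb2
  -- (3) pairs: for `e < sa` the tail slots `(k̄, n-1-e)` and `(k₃, n₃-1-e)` share a component,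
  -- hence a letter: `T_b[sa-1-e] = (V[e])⁻¹`
  have hletter : ∀ e, e < sa →
      (fac κ.U k₃)[n₃ - 1 - e]? = ((fac κ.U k)[e]?).map fun z => (z.1, !z.2) := by
    intro e he
    have hecb : e < cb := by omega
    have hσ : IsSlot κ.U (k, e) := ⟨hkU, by dsimp only; omega⟩
    have ht1 : IsTailSlot κ.U (κ.bar k, n - 1 - e) :=
      κ.isTailSlot_of_portalAt_left_of_inside hg1 hI hM hmin hP2 hk hPa hin he
    have ht2 : IsTailSlot κ.U (k₃, n₃ - 1 - e) := κ.pj_isTailSlot_spur hk₃ hecb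
    have hsc' := sameComp_of_crossing_pair_level hN hU hbar hP2s
      (ε₂ := cedge κ.U (k₃, n₃ - 1 - e)) (isEdge_fedge hσ) ((hXf e).2 he)
      ⟨(k, e), mem_fedge.2 (Or.inl rfl), hLf e he _ (mem_fedge.2 (Or.inl rfl))⟩
      (fun ε' hε' hc' hlev => by
        rcases hclass ε' hε' hc' e hlev with ⟨-, h⟩ | ⟨-, h⟩
        · exact Or.inl h
        · exact Or.inr h)
      (κ.bar k, n - 1 - e) (mem_fedge.2 (Or.inr rfl)) (k₃, n₃ - 1 - e) (mem_cedge.2 (Or.inl rfl))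
    have hL := hsc'.slotLetter_eq_of_slotType_eq hN hU hbar
      (by rw [ht2.slotType_eq, ht1.slotType_eq])
    have hfp : slotLetter κ.U (κ.bar k, n - 1 - e) =
        ((slotLetter κ.U (k, e)).1, !(slotLetter κ.U (k, e)).2) := hbar.slotLetter_fpartner hσ
    have e1 : (fac κ.U k₃)[n₃ - 1 - e]? = some (slotLetter κ.U (k₃, n₃ - 1 - e)) :=
      ht2.1.getElem?_eq
    have e2 : (fac κ.U k)[e]? = some (slotLetter κ.U (k, e)) := hσ.getElem?_eq
    rw [e1, e2, hL, hfp, Option.map_some]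
  -- the spur word is the inverse of the pre-cut part of `V`
  have hT : CycFactors.tail κ.U k₃ = FreeGroup.invRev ((fac κ.U k).take sa) := by
    refine pj_eq_invRev_take (by omega) (by rw [CycFactors.length_tail]; exact hcbsa) fun e he => ?_
    rw [← hletter e he, CycFactors.tail, List.getElem?_drop]
    congr 1
    omega
  -- (4) vertices: the spur tip `E_{k₃+1}` is `E_k`
  have hva : κ.absv d.a = κ.occStart k * proj g (FreeGroup.mk ((fac κ.U k).take sa)) := by
    have e : kpos κ.U (k, sa) = d.a := κ.kpos_slotAt hPa.1.le
    rw [← e]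
    exact κ.absv_kpos hN hk (by omega) (by omega)
  have hvab : κ.absv d.a = κ.absv d.b := (κ.absv_eq_absv_iff _ _).2 d.pv_eq
  have hocc : κ.occStart (k₃ + 1) = κ.occStart k := by
    rw [κ.occStart_succ_eq_absv_mul_tail hN hk₃, hKb, ← hvab, hva, hT, ← FreeGroup.inv_mk,
      map_inv, mul_inv_cancel_right]
  -- (5) the block `k, …, k₃` is symbol-closed, non-empty and proper
  have hinside := κ.pj_inside_iff hg1 hI hM hmin hPa hKb
  refine false_of_occStart_eq hI κ (j₁ := k) (j₂ := k₃ + 1) hkk₄ (by omega) (by omega)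
    (κ.blockClosed_of_bar fun j hj h1 h2 => ?_) hocc.symm
  have hbj : κ.bar j < κ.w.length := κ.bar_lt hj
  rcases h1.eq_or_lt with rfl | hkj
  · have := (hinside _).1 hin
    exact ⟨by omega, by omega⟩
  · have hjin : κ.Inside d.a d.b j := (hinside j).2 ⟨hkj, h2⟩
    by_cases hbjk : κ.bar j = k
    · rw [hbjk]
      exact ⟨le_rfl, hkk₄⟩
    · have hna : ¬ κ.PortalAt d.a j := fun h => by
        have := κ.portalAt_unique h hPa
        omega
      have hna' : ¬ κ.PortalAt d.a (κ.bar j) := fun h => hbjk (κ.portalAt_unique h hPa)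
      have hbin := (κ.inside_iff_inside_bar hg1 hI hM hmin hP2 hj hna
        (κ.not_portalAt_of_isJunction hJb j) hna' (κ.not_portalAt_of_isJunction hJb _)).1 hjin
      have := (hinside _).1 hbin
      exact ⟨by omega, by omega⟩

end PJ

end Config

end SurfaceGroup

end Literature.Topology.FourManifolds

end
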